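import Literature.NumberTheory.LFunctions.UniformWeilPositivityRH
import Literature.NumberTheory.LFunctions.WeilArchimedeanPositivityHolds
import Literature.NumberTheory.LFunctions.WeilFirstPrimePositivityC
import Literature.NumberTheory.LFunctions.WeilTwoPrimePos59
import Literature.NumberTheory.LFunctions.WeilTwoPrimeQuadratic
import Literature.NumberTheory.LFunctions.YoshidaPositivityThreshold
import Literature.NumberTheory.LFunctions.WeilSemilocalQuadratic
import Summits.RiemannHypothesis.RiemannHypothesis.Theorems.GroundBartaEvenWinsBeyondArchDeflationConsequences
import HarnessLib

/-!
# Motivic door — the LADDER of Weil-positivity rungs, typed (pub-rhdoor seat lad-1)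

HONEST FRAMING (verbatim, governs every line below): lottery ticket at the motivic door; RH probability
negligible; consolation prizes are real: a new semi-local Weil-positivity theorem, or a located gap in
the Connes–Consani programme, plus the ff-door theorem.  This file makes NO claim about `ζ` beyond the
tree's theorems it cites by name; it is the kernel-checked REGISTRY of the ladder kept in prose in the
cell's `LADDER.md` (§1 rung table), plus the small glue that turns each rung into a statement about
Yoshida's threshold `a₀ = weilPositivityThreshold`, plus the typed INTERFACE of the first open rung.

The ladder (TYPE II: every rung is a case of RH by Weil's criterion, `rung_of_riemannHypothesis`;
`R∞` says the rungs exhaust RH):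

| rung | window `a` (Weil positivity on `C(a)`, `supp g ⊆ [-a,a]`) | status | decl |
|---|---|---|---|
| R0 | criterion `RH ↔ ∀ a>0` | PROVED | `riemannHypothesis_iff_forall_weilPositivityOn` |
| R1 | `(log 2)/2 = 0.3466` (archimedean; Yoshida 1992 Thm 1 = CC 2021 range) | PROVED | `weilPositivityOn_log_two_half_holds` |
| R2 | `(log 3)/2 = 0.5493` (first prime) | PROVED | `weilPositivityOn_log_three_half` |
| R2c | `59/100` (two-prime form, `T = 80` certificate) | PROVED | `weilPositivityOn_59_100` |
| R3-op | semi-local `{∞,2}` form on `C((log 3)/2)` and `C(563/1024)` | PROVED | `weilSemilocalPositivityOn_two_log_three_half`, `…_two_certb` |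
| R3-full | `{∞,2}` form on every window | REFUTED (theorems `exists_not_weilSemilocalPositivityOn_two`, `not_weilSemilocalPositivityOn_two_of_log_two_le`: false at every `a ≥ log 2`; DATA locates the first failure `≈ 0.5578`) | `Literature/…/WeilSemilocalNegative.lean`, `…/WeilSemilocalWindow.lean` |
| R4a | `log 2 = 0.6931` (two-prime form `E₂₃` on its full window) | OPEN — interface `rung_R4a_of_blocks` | — |
| R4d–R4f | `(log 5)/2 = 0.8047`, `1`, `log 3 = 1.0986` | OPEN — interface `MotivicDoor.SliverBridge.dt_weil{Even,Odd}GroundEnergy_ge_of_deflCert_sliverLoss` + `rung_of_sector_lower_bounds` (two-prime certificates with level `β₂₃ > weilSliverLoss 3 N`; DATA: deflated-Temple bound feasible in floating point at `(log 5)/2`) | `MotivicDoorSliverBridge.lean` |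
| R∞ | all finite-prime windows `(log (N+1))/2` | `↔ RH` | `riemannHypothesis_iff_forall_finitePrimeWindow` |

`RiemannHypothesis` in every statement below is the SUMMIT constant `Summit.RiemannHypothesis`
(definitionally Mathlib's `RiemannHypothesis`, `Summit.RiemannHypothesis_iff`); the Literature theorems
cited are stated for Mathlib's and are used through that definitional equality.

DATA vs PROVED: every `theorem` here is PROVED with the standard axiom closure; every number tagged
DATA above lives only in `LADDER.md` with its engines and is NOT used in any statement.

Contents.
* §A registry: the landed rungs bound BY NAME (kernel-checked `example`s — the gate forbids verbatim
  re-exports), R0/R1 in window form, the on-path lemma, the ORDER of the rung windows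
  (`(log 2)/2 < (log 3)/2 < 59/100 < log 2 < 1733/2500`), the proved reach `a ≤ 59/100`, and `R∞`.
* §B threshold glue (uses `YoshidaPositivityThreshold`): under `¬RH`, `WeilPositivityOn a ↔ a ≤ a₀`
  for `a > 0`; hence each proved rung `r` is the theorem `RH ∨ r ≤ a₀`, currently `r = 59/100`
  (`riemannHypothesis_or_threshold_ge_59_100`), and unconditionally
  `WeilPositivityOn a ↔ RH ∨ a ≤ a₀`.
* §C the first open rung R4a = `WeilPositivityOn (log 2)`: its two-prime analytic form
  (`weilPositivityOn_log_two_iff`), and its INTERFACE to the deflated-Temple sector mechanism of the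
  `EvenWinsBeyondArch` files (`dt_weilPositivityOn`): non-negativity of the even and odd sector ground
  energies on ANY window `c ≥ log 2` — e.g. the two-prime certificate window `c = 1733/2500` — gives R4a.
  The two sector inequalities are the located work; nothing here proves them.  Every rung implies
  the SLACK rung `-‖g‖₂² ≤ Re Q(g)` on the same window (`slackRung_of_rung`), so the same blocks serve
  route WeilPos's open item `WeilposSlackRungLog2` (`slackRungLog2_of_blocks`, conclusion verbatim).

References: A. Weil 1952 (criterion); H. Yoshida, Adv. Stud. Pure Math. 21 (1992) Thm 1, Prop. 6;
E. Bombieri, Rend. Mat. Acc. Lincei (9) 11 (2000) §4; A. Connes, C. Consani, "Weil positivity and trace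
formula, the archimedean place", Selecta Math. 27 (2021) (range `λ² < 2`, i.e. R1).
-/

set_option linter.dupNamespace false  -- the mandated namespace repeats `RiemannHypothesis`

noncomputable section

open Set Literature.NumberTheory.LFunctions
open Summit.RiemannHypothesis.RiemannHypothesis.Theorems.EvenWinsBeyondArch

namespace Summit.RiemannHypothesis.RiemannHypothesis.Theorems.MotivicDoor.Rungs

/-! ## §A  The rung registry -/

/-- **R0 — Weil's criterion in Yoshida's window form**: RH holds iff Weil positivity holds on every
window. [cite: Yoshida1992HermitianForms, Thm. 1 and Prop. 6; Bombieri2000Weil, §4] -/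
theorem rung_R0 : Summit.RiemannHypothesis ↔ ∀ a : ℝ, 0 < a → WeilPositivityOn a :=
  riemannHypothesis_iff_forall_weilPositivityOn

/-- **R1 — the archimedean rung** `C((log 2)/2)` (no prime visible). [cite: Yoshida1992HermitianForms, Thm. 1 (p. 310)] -/
theorem rung_R1 : WeilPositivityOn (Real.log 2 / 2) := weilPositivityOn_log_two_half_holds

-- R2 — the first-prime rung `C((log 3)/2)` (only `p = 2` visible): LANDED as
-- `weilPositivityOn_log_three_half` [Yoshida 1992 §6 method; certificate in tree].
example : WeilPositivityOn (Real.log 3 / 2) := weilPositivityOn_log_three_half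

-- R2c — the `59/100` rung (primes `2, 3` visible; two-prime form, `T = 80` certificate): LANDED as
-- `weilPositivityOn_59_100`.
example : WeilPositivityOn (59 / 100) := weilPositivityOn_59_100

-- R3-op — the semi-local `{∞,2}` rung on `C((log 3)/2)` and, strictly beyond, on `C(563/1024)`: LANDED as
-- `weilSemilocalPositivityOn_two_log_three_half`, `weilSemilocalPositivityOn_two_certb`.
example : WeilSemilocalPositivityOn {2} (Real.log 3 / 2) := weilSemilocalPositivityOn_two_log_three_half
example : WeilSemilocalPositivityOn {2} ((weilCert3C.b : ℚ) : ℝ) := weilSemilocalPositivityOn_two_certb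

-- monotonicity (a rung implies every lower rung): LANDED as `WeilPositivityOn.mono`.
example {a b : ℝ} (hab : a ≤ b) (h : WeilPositivityOn b) : WeilPositivityOn a := h.mono hab

/-- ON-PATH LEMMA (type II ladder): every rung is a case of RH. [cite: Bombieri2000Weil, §4] -/
theorem rung_of_riemannHypothesis (h : Summit.RiemannHypothesis) {a : ℝ} (ha : 0 < a) : WeilPositivityOn a :=
  (riemannHypothesis_iff_forall_weilPositivityOn.mp h) a ha

-- Order of the rung windows, 1/4: `(log 2)/2 < (log 3)/2` is LANDED as
-- `EvenWinsBeyondArch.log_two_half_lt_log_three_half` (Theorems/WeilParityEvenWinsBeyondArchSplit.lean).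

/-- Order of the rung windows, 2/4: `(log 3)/2 < 59/100` (`exp (59/50) > 3`). [folklore] -/
theorem window_R2_lt_R2c : Real.log 3 / 2 < (59 / 100 : ℝ) := by
  have h : Real.log 3 < 59 / 50 := by
    rw [Real.log_lt_iff_lt_exp (by norm_num)]
    have h6 := Real.sum_le_exp_of_nonneg (x := (59 / 50 : ℝ)) (by norm_num) 6
    simp only [Finset.sum_range_succ, Finset.sum_range_zero, Nat.factorial] at h6
    norm_num at h6
    linarith
  linarith

/-- Order of the rung windows, 3/4: `59/100 < log 2`. [folklore] -/
theorem window_R2c_lt_R4a : (59 / 100 : ℝ) < Real.log 2 := by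
  have h := Real.log_two_gt_d9
  linarith

/-- Order of the rung windows, 4/4: `log 2 < 1733/2500` (the window of the two-prime certificate `L2`). [folklore] -/
theorem window_R4a_lt_L2 : Real.log 2 < (1733 / 2500 : ℝ) := by
  have h := Real.log_two_lt_d9
  linarith

/-- The current PROVED reach of the ladder as one statement: Weil positivity on every window
`a ≤ 59/100`. [cite: Bombieri2000Weil, §4] -/
theorem rung_reach (a : ℝ) (ha : a ≤ 59 / 100) : WeilPositivityOn a := weilPositivityOn_59_100.mono ha

/-- **R∞ — the ladder is exhaustive**: RH holds iff Weil positivity holds on every finite-prime window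
`C((log (N+1))/2)`, `N : ℕ` (the window on which exactly the prime powers `≤ N` are visible).
[cite: Yoshida1992HermitianForms, Prop. 6; Bombieri2000Weil, §4] -/
theorem riemannHypothesis_iff_forall_finitePrimeWindow :
    Summit.RiemannHypothesis ↔ ∀ N : ℕ, WeilPositivityOn (Real.log ((N : ℝ) + 1) / 2) := by
  rw [rung_R0]
  refine ⟨fun h N ↦ (h (Real.log ((N : ℝ) + 1) / 2 + 1) ?_).mono (by linarith), fun h a ha ↦ ?_⟩
  · have h0 : 0 ≤ Real.log ((N : ℝ) + 1) := Real.log_nonneg (by simp)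
    linarith
  · refine (h ⌈Real.exp (2 * a)⌉₊).mono ?_
    have h1 : Real.exp (2 * a) ≤ (⌈Real.exp (2 * a)⌉₊ : ℝ) + 1 := (Nat.le_ceil _).trans (by linarith)
    have h2 : 2 * a ≤ Real.log ((⌈Real.exp (2 * a)⌉₊ : ℝ) + 1) := by
      rw [Real.le_log_iff_exp_le (by positivity)]
      exact h1
    linarith

/-! ## §B  Rungs as statements about Yoshida's threshold `a₀` -/

/-- Under `¬RH`, a Weil-positive window lies below the threshold: `WeilPositivityOn a → a ≤ a₀`.
[cite: Yoshida1992HermitianForms, Prop. 6 (p. 320)] -/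
theorem le_threshold_of_weilPositivityOn (hRH : ¬ Summit.RiemannHypothesis) {a : ℝ} (ha : 0 < a)
    (h : WeilPositivityOn a) : a ≤ weilPositivityThreshold := by
  unfold weilPositivityThreshold
  exact le_csSup (bddAbove_weilPositivitySet_of_not_riemannHypothesis hRH) ⟨ha, h⟩

/-- Under `¬RH` the Weil-positive windows are EXACTLY `(0, a₀]`. [cite: Yoshida1992HermitianForms, Prop. 6 (p. 320)] -/
theorem weilPositivityOn_iff_le_threshold (hRH : ¬ Summit.RiemannHypothesis) {a : ℝ} (ha : 0 < a) :
    WeilPositivityOn a ↔ a ≤ weilPositivityThreshold :=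
  ⟨le_threshold_of_weilPositivityOn hRH ha, (Yoshida1992_prop6 hRH).2.1 a⟩

/-- Under `¬RH`, failure of a rung means the threshold sits strictly below it. [cite: Yoshida1992HermitianForms, Prop. 6 (p. 320)] -/
theorem not_weilPositivityOn_iff_threshold_lt (hRH : ¬ Summit.RiemannHypothesis) {a : ℝ} (ha : 0 < a) :
    ¬ WeilPositivityOn a ↔ weilPositivityThreshold < a := by
  rw [weilPositivityOn_iff_le_threshold hRH ha, not_le]

/-- UNCONDITIONAL reading of any window: `WeilPositivityOn a ↔ RH ∨ a ≤ a₀` (`a > 0`).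
[cite: Yoshida1992HermitianForms, Prop. 6 (p. 320)] -/
theorem weilPositivityOn_iff_rh_or_le_threshold {a : ℝ} (ha : 0 < a) :
    WeilPositivityOn a ↔ Summit.RiemannHypothesis ∨ a ≤ weilPositivityThreshold := by
  by_cases hRH : Summit.RiemannHypothesis
  · exact ⟨fun _ ↦ Or.inl hRH, fun _ ↦ rung_of_riemannHypothesis hRH ha⟩
  · rw [weilPositivityOn_iff_le_threshold hRH ha]
    exact ⟨Or.inr, fun h ↦ h.resolve_left hRH⟩

/-- **Rung R2c on the threshold**: if RH fails, `59/100 ≤ a₀` (Yoshida's own bound: `(log 2)/2`; the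
tree's `Yoshida1992_prop6`: `(log 3)/2`). [cite: Yoshida1992HermitianForms, Prop. 6 (p. 320)] -/
theorem rung_R2c_threshold (hRH : ¬ Summit.RiemannHypothesis) : (59 / 100 : ℝ) ≤ weilPositivityThreshold :=
  le_threshold_of_weilPositivityOn hRH (by norm_num) weilPositivityOn_59_100

/-- **The dichotomy of record** (unconditional): RH, or Yoshida's threshold exists, is `≥ 59/100`, and
separates the Weil-positive windows from the others. [cite: Yoshida1992HermitianForms, Prop. 6 (p. 320)] -/
theorem riemannHypothesis_or_threshold_ge_59_100 :
    Summit.RiemannHypothesis ∨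
      ((59 / 100 : ℝ) ≤ weilPositivityThreshold ∧
        (∀ a : ℝ, a ≤ weilPositivityThreshold → WeilPositivityOn a) ∧
        (∀ a : ℝ, weilPositivityThreshold < a → ¬ WeilPositivityOn a)) := by
  by_cases hRH : Summit.RiemannHypothesis
  · exact Or.inl hRH
  · exact Or.inr ⟨rung_R2c_threshold hRH, (Yoshida1992_prop6 hRH).2⟩

/-- What climbing buys: a PROVED rung at window `r` upgrades the dichotomy to `RH ∨ r ≤ a₀`.
[cite: Yoshida1992HermitianForms, Prop. 6 (p. 320)] -/
theorem rh_or_le_threshold_of_rung {r : ℝ} (hr : 0 < r) (h : WeilPositivityOn r) :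
    Summit.RiemannHypothesis ∨ r ≤ weilPositivityThreshold :=
  (weilPositivityOn_iff_rh_or_le_threshold hr).1 h

/-! ## §C  The first open rung R4a = `WeilPositivityOn (log 2)` : analytic form and interface -/

-- R4a in analytic form — positivity of the two-prime form `E₂₃` on its full window `C(log 2)` — is
-- LANDED as `weilPositivityOn_log_two_iff` [Yoshida 1992 §6, the `p^m`-terms with `p^m ≤ 3`].
example : WeilPositivityOn (Real.log 2) ↔
    ∀ g : ℝ → ℂ, IsWeilTest g → tsupport g ⊆ Icc (-Real.log 2) (Real.log 2) →
      0 ≤ weilTwoPrimeQuadratic g := weilPositivityOn_log_two_iff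

/-- R4a is on path (a case of RH). [cite: Bombieri2000Weil, §4] -/
theorem rung_R4a_of_riemannHypothesis (h : Summit.RiemannHypothesis) : WeilPositivityOn (Real.log 2) :=
  rung_of_riemannHypothesis h (Real.log_pos (by norm_num))

/-- R4a would lift the dichotomy to `RH ∨ log 2 ≤ a₀`. [cite: Yoshida1992HermitianForms, Prop. 6 (p. 320)] -/
theorem rh_or_log_two_le_threshold_of_R4a (h : WeilPositivityOn (Real.log 2)) :
    Summit.RiemannHypothesis ∨ Real.log 2 ≤ weilPositivityThreshold :=
  rh_or_le_threshold_of_rung (Real.log_pos (by norm_num)) h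

/-- **INTERFACE, general form**: non-negative even AND odd sector ground energies on a window `c`
(the two deliverables of the deflated-Temple sector mechanism, `dt_weilPositivityOn`) give every rung
`a ≤ c`. [cite: Yoshida1992HermitianForms, Prop. 6; Bombieri2000Weil, §4] -/
theorem rung_of_sector_blocks {c a : ℝ} (hev : 0 ≤ weilEvenGroundEnergy c)
    (hod : 0 ≤ weilOddGroundEnergy c) (hac : a ≤ c) : WeilPositivityOn a :=
  (dt_weilPositivityOn hev hod).mono hac

/-- **INTERFACE of rung R4a at the two-prime certificate window `c = 1733/2500`**: the even and odd
sector blocks there give `WeilPositivityOn (log 2)` (and the window `1733/2500` itself,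
`dt_weilPositivityOn`). These two hypotheses are the located open work of the ladder.
[cite: Yoshida1992HermitianForms, Prop. 6; Bombieri2000Weil, §4] -/
theorem rung_R4a_of_blocks (hev : 0 ≤ weilEvenGroundEnergy (1733 / 2500 : ℝ))
    (hod : 0 ≤ weilOddGroundEnergy (1733 / 2500 : ℝ)) : WeilPositivityOn (Real.log 2) :=
  rung_of_sector_blocks hev hod window_R4a_lt_L2.le

/-- The same blocks at ANY window `c ≥ log 2` suffice for R4a (e.g. `c = log 2` itself, or `18/25`).
[cite: Yoshida1992HermitianForms, Prop. 6; Bombieri2000Weil, §4] -/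
theorem rung_R4a_of_blocks_ge {c : ℝ} (hc : Real.log 2 ≤ c) (hev : 0 ≤ weilEvenGroundEnergy c)
    (hod : 0 ≤ weilOddGroundEnergy c) : WeilPositivityOn (Real.log 2) :=
  rung_of_sector_blocks hev hod hc

/-- Every rung implies the SLACK rung on the same window (`-‖g‖₂² ≤ Re Q(g)`; route WeilPos climbs the
slack ladder, its first open rung being the window `log 2`, item `WeilposSlackRungLog2`).
[cite: Bombieri2000Weil, §4] -/
theorem slackRung_of_rung {a : ℝ} (h : WeilPositivityOn a) :
    ∀ g : ℝ → ℂ, IsWeilTest g → tsupport g ⊆ Icc (-a) a →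
      -(∫ t, ‖g t‖ ^ 2) ≤ (weilQuadratic g).re :=
  fun g hg hs ↦ (neg_nonpos.2 (MeasureTheory.integral_nonneg fun _ ↦ by positivity)).trans (h g hg hs)

/-- The slack rung holds outright on the PROVED reach `a ≤ 59/100`. [cite: Bombieri2000Weil, §4] -/
theorem slackRung_of_le_59_100 {a : ℝ} (ha : a ≤ 59 / 100) :
    ∀ g : ℝ → ℂ, IsWeilTest g → tsupport g ⊆ Icc (-a) a →
      -(∫ t, ‖g t‖ ^ 2) ≤ (weilQuadratic g).re :=
  slackRung_of_rung (rung_reach a ha)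

/-- **INTERFACE to route WeilPos's open slack rung at `log 2`** (item `WeilposSlackRungLog2`, typed
verbatim as the conclusion): the two sector blocks at the certificate window `1733/2500` give it, via R4a.
[cite: Yoshida1992HermitianForms, Prop. 6; Bombieri2000Weil, §4] -/
theorem slackRungLog2_of_blocks (hev : 0 ≤ weilEvenGroundEnergy (1733 / 2500 : ℝ))
    (hod : 0 ≤ weilOddGroundEnergy (1733 / 2500 : ℝ)) :
    ∀ g : ℝ → ℂ, IsWeilTest g → tsupport g ⊆ Icc (-Real.log 2) (Real.log 2) →
      -(∫ t, ‖g t‖ ^ 2) ≤ (weilQuadratic g).re :=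
  slackRung_of_rung (rung_R4a_of_blocks hev hod)

end Summit.RiemannHypothesis.RiemannHypothesis.Theorems.MotivicDoor.Rungs

end
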